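import Mathlib
import Literature.Barriers.ValiantsHypothesis.AlgebraicNaturalProofs
import Literature.Computability.AlgebraicComplexity.ArithCircuitProofs
import Literature.Computability.AlgebraicComplexity.IMMInVPProofs
import Summits.ValiantsHypothesis.ValiantsHypothesis.Theorems.BarrierLeverPartitionMinorsHitByVPTwinFreeLift
import Summits.ValiantsHypothesis.ValiantsHypothesis.Theorems.BarrierLeverPartitionMinorsHitByVPTwinMatching

/-!
# Route BarrierLever — item `PartitionMinorsHitByVP` (stmt-ValiantsHypothesis-19717):
# the TWIN-ABSORPTION CONTRACTION DOORS (twin pairs on one side against a literal split on the other)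

Helper file (`--supports stmt-ValiantsHypothesis-19717`; cell valiant-natproofs, rung V4, 𝒟-side,
prover seat val-np-p3 gen 3). Definition-free. Closes NO item.

Companion of `…TwinMatching` (equal twin counts on the two sides). Contract the coordinate pair
`(a, c)`. Here the `a`-TWIN PAIRS `{U, U ∪ {a}}` among the rows are absorbed by the plain literal
split of the COLUMNS at `c` (no twin structure needed on the column side): if the number of `a`-twin
pairs among the rows equals the number of columns CONTAINING `c`, and ONE polynomial `g` certifies
* (all row classes, one representative each — the bottom when present) × (the columns `W ∌ c`), and
* (the twin-top rows) × (the columns `W ∋ c`, contracted),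
then `f = g₀ · ((1 + x_a)(1 + y_c) + x_a y_c)` certifies `(u, w)`: after the row operations
«twin-top row −= its bottom row» the layout matrix of `f` is block upper-triangular with diagonal
blocks the two certified matrices (`det_twinAbsorbRows_ne_zero`); cost `L(f) ≤ L(g) + 7`,
`deg f ≤ deg g + 2`. The transposed door (column twins absorbed by the row split at `a`) is
`partitionMinor_hit_of_twinAbsorptionCols`. The variants with the roles of `W ∋ c` / `W ∌ c`
exchanged hold by the same computation with the transposed `2 × 2` table; they are not spelled out.

In TNS / TT language (items 19126 / 19152) these are REDUCTIONS: with `tw_a(u)` the number of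
`a`-twin pairs of `u` and `q_c(w)` the number of members of `w` containing `c`, a minimal
counterexample has `tw_a(u) ≠ q_c(w)` and `q_a(u) ≠ tw_c(w)` for all `a, c` (besides R1's
`q_a(u) ≠ q_c(w)` and twin matching's `tw_a(u) ≠ tw_c(w)`).

* `det_twinAbsorbRows_ne_zero`, `det_twinAbsorbCols_ne_zero` — the matrix engines (exact block
  triangularity, any `μ ≠ 0`).
* **`partitionMinor_hit_of_twinAbsorptionRows`**, **`partitionMinor_hit_of_twinAbsorptionCols`** —
  the doors (degree-free bookkeeping, any index type; `SmallCircuits` form via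
  `…StrataDoor.exists_smallCircuits_of_sized`, common `g` via `…TwinMatching.exists_common_witness`).

WHAT THIS IS NOT: one reduction step; nothing on which layouts reduce to few good leaves (the
content of item 19717), on crux 14610 or on VP vs VNP.
-/

set_option linter.dupNamespace false

namespace Summit.ValiantsHypothesis.ValiantsHypothesis.Theorems.BarrierLever.TwinMatching

open Finset
open Literature.Barriers.ValiantsHypothesis Literature.Computability.AlgebraicComplexity
open Summit.ValiantsHypothesis.ValiantsHypothesis.Theorems.BarrierLever.StrataDoor
  (complexity_killVars_le totalDegree_killVars_le)

/-! ## 1. The matrix engines -/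

section Engine

variable {κ₁ κ₂ : Type*} [Fintype κ₁] [DecidableEq κ₁] [Fintype κ₂] [DecidableEq κ₂]

/-- **Row twins absorbed by a column split.** Rows: representatives `κ₁` and twin tops `κ₂` with
bottoms `c₁` (bottom unmarked, top marked, equal labels); columns: unmarked `κ₁`, marked `κ₂`.
If `Mf` is nonsingular on representatives × unmarked columns and on twin tops × marked columns,
then `Mf (ρ i) (ρ' j) · (1 + μ·[top i][top' j])` is nonsingular for every `μ ≠ 0`. -/
theorem det_twinAbsorbRows_ne_zero {ι α β : Type*} [Fintype ι] [DecidableEq ι]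
    (Mf : α → β → ℂ) (ρ : ι → α) (ρ' : ι → β) (top top' : ι → Prop)
    [DecidablePred top] [DecidablePred top']
    (erow ecol : κ₁ ⊕ κ₂ ≃ ι) (c₁ : κ₂ → κ₁)
    (hr₁ : ∀ k, ¬ top (erow (Sum.inl (c₁ k)))) (hr₂ : ∀ k, top (erow (Sum.inr k)))
    (hr₃ : ∀ k, ρ (erow (Sum.inr k)) = ρ (erow (Sum.inl (c₁ k))))
    (hc₀ : ∀ k, ¬ top' (ecol (Sum.inl k))) (hc₁ : ∀ k, top' (ecol (Sum.inr k)))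
    (μ : ℂ) (hμ : μ ≠ 0)
    (H₁ : (Matrix.of fun k k' : κ₁ =>
      Mf (ρ (erow (Sum.inl k))) (ρ' (ecol (Sum.inl k')))).det ≠ 0)
    (H₂ : (Matrix.of fun k k' : κ₂ =>
      Mf (ρ (erow (Sum.inr k))) (ρ' (ecol (Sum.inr k')))).det ≠ 0) :
    (Matrix.of fun i j : ι =>
      Mf (ρ i) (ρ' j) * (if top i ∧ top' j then 1 + μ else 1)).det ≠ 0 := by
  classical
  set M₁₁ : Matrix κ₁ κ₁ ℂ := Matrix.of fun k k' : κ₁ =>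
    Mf (ρ (erow (Sum.inl k))) (ρ' (ecol (Sum.inl k'))) with hM₁₁
  set M₂₂ : Matrix κ₂ κ₂ ℂ := Matrix.of fun k k' : κ₂ =>
    Mf (ρ (erow (Sum.inr k))) (ρ' (ecol (Sum.inr k'))) with hM₂₂
  set N : Matrix ι ι ℂ := Matrix.of fun i j : ι =>
    Mf (ρ i) (ρ' j) * (if top i ∧ top' j then 1 + μ else 1) with hN
  set N' : Matrix (κ₁ ⊕ κ₂) (κ₁ ⊕ κ₂) ℂ := N.submatrix erow ecol with hN'
  have hdet : N'.det ≠ 0 → N.det ≠ 0 := by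
    intro h hz
    apply h
    have hNN : N' = (N.submatrix id ⇑(erow.symm.trans ecol)).submatrix erow erow := by
      ext i j
      simp [hN', Matrix.submatrix_apply]
    rw [hNN, Matrix.det_submatrix_equiv_self, Matrix.det_permute', hz, mul_zero]
  apply hdet
  set P : Matrix κ₂ κ₁ ℂ := Matrix.of fun (k₂ : κ₂) (k : κ₁) => if k = c₁ k₂ then (1 : ℂ) else 0
    with hP
  have hPmul₁ : ∀ (Z : Matrix κ₁ κ₁ ℂ) (k₂ : κ₂) (j : κ₁), (P * Z) k₂ j = Z (c₁ k₂) j := by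
    intro Z k₂ j
    simp [Matrix.mul_apply, hP, ite_mul, Finset.sum_ite_eq']
  have hPmul₂ : ∀ (Z : Matrix κ₁ κ₂ ℂ) (k₂ : κ₂) (j : κ₂), (P * Z) k₂ j = Z (c₁ k₂) j := by
    intro Z k₂ j
    simp [Matrix.mul_apply, hP, ite_mul, Finset.sum_ite_eq']
  set A₁₁ : Matrix κ₁ κ₁ ℂ := Matrix.of fun k k' => N (erow (Sum.inl k)) (ecol (Sum.inl k'))
    with hA₁₁
  set A₁₂ : Matrix κ₁ κ₂ ℂ := Matrix.of fun k k' => N (erow (Sum.inl k)) (ecol (Sum.inr k'))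
    with hA₁₂
  set A₂₁ : Matrix κ₂ κ₁ ℂ := Matrix.of fun k k' => N (erow (Sum.inr k)) (ecol (Sum.inl k'))
    with hA₂₁
  set A₂₂ : Matrix κ₂ κ₂ ℂ := Matrix.of fun k k' => N (erow (Sum.inr k)) (ecol (Sum.inr k'))
    with hA₂₂
  have hN'b : N' = Matrix.fromBlocks A₁₁ A₁₂ A₂₁ A₂₂ := by
    ext (i | i) (j | j) <;> rfl
  have key : Matrix.fromBlocks 1 0 (-P) 1 * N' = Matrix.fromBlocks M₁₁ A₁₂ 0 (μ • M₂₂) := by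
    rw [hN'b, Matrix.fromBlocks_multiply]
    simp only [Matrix.one_mul, Matrix.zero_mul, add_zero, Matrix.neg_mul]
    ext (k | k) (k' | k')
    · simp only [Matrix.fromBlocks_apply₁₁, hA₁₁, Matrix.of_apply, hN, hM₁₁]
      have h0 := hc₀ k'
      simp [h0]
    · rfl
    · simp only [Matrix.fromBlocks_apply₂₁, Matrix.add_apply, Matrix.neg_apply, hPmul₁,
        hA₁₁, hA₂₁, Matrix.of_apply, hN, Matrix.zero_apply]
      rw [hr₃ k]
      have h0 := hc₀ k'
      simp [h0]
    · simp only [Matrix.fromBlocks_apply₂₂, Matrix.add_apply, Matrix.neg_apply, hPmul₂,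
        hA₁₂, hA₂₂, Matrix.of_apply, hN, hM₂₂, Matrix.smul_apply, smul_eq_mul]
      rw [hr₃ k]
      have h1 := hr₁ k
      have h2 := hr₂ k
      have h3 := hc₁ k'
      simp [h1, h2, h3]
      ring
  have hR : (Matrix.fromBlocks (1 : Matrix κ₁ κ₁ ℂ) 0 (-P) (1 : Matrix κ₂ κ₂ ℂ)).det = 1 := by
    rw [Matrix.det_fromBlocks_zero₁₂, Matrix.det_one, Matrix.det_one, mul_one]
  intro hz
  have hk := congrArg Matrix.det key
  rw [Matrix.det_mul, hR, one_mul, hz, Matrix.det_fromBlocks_zero₂₁, Matrix.det_smul] at hk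
  exact mul_ne_zero H₁ (mul_ne_zero (pow_ne_zero _ hμ) H₂) hk.symm

/-- **Column twins absorbed by a row split** (the transpose of `det_twinAbsorbRows_ne_zero`).
Rows: unmarked `κ₁`, marked `κ₂`; columns: representatives `κ₁` and twin tops `κ₂` with bottoms
`c₂`. -/
theorem det_twinAbsorbCols_ne_zero {ι α β : Type*} [Fintype ι] [DecidableEq ι]
    (Mf : α → β → ℂ) (ρ : ι → α) (ρ' : ι → β) (top top' : ι → Prop)
    [DecidablePred top] [DecidablePred top']
    (erow ecol : κ₁ ⊕ κ₂ ≃ ι) (c₂ : κ₂ → κ₁)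
    (hr₀ : ∀ k, ¬ top (erow (Sum.inl k))) (hr₁ : ∀ k, top (erow (Sum.inr k)))
    (hc₁ : ∀ k, ¬ top' (ecol (Sum.inl (c₂ k)))) (hc₂ : ∀ k, top' (ecol (Sum.inr k)))
    (hc₃ : ∀ k, ρ' (ecol (Sum.inr k)) = ρ' (ecol (Sum.inl (c₂ k))))
    (μ : ℂ) (hμ : μ ≠ 0)
    (H₁ : (Matrix.of fun k k' : κ₁ =>
      Mf (ρ (erow (Sum.inl k))) (ρ' (ecol (Sum.inl k')))).det ≠ 0)
    (H₂ : (Matrix.of fun k k' : κ₂ =>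
      Mf (ρ (erow (Sum.inr k))) (ρ' (ecol (Sum.inr k')))).det ≠ 0) :
    (Matrix.of fun i j : ι =>
      Mf (ρ i) (ρ' j) * (if top i ∧ top' j then 1 + μ else 1)).det ≠ 0 := by
  classical
  set M₁₁ : Matrix κ₁ κ₁ ℂ := Matrix.of fun k k' : κ₁ =>
    Mf (ρ (erow (Sum.inl k))) (ρ' (ecol (Sum.inl k'))) with hM₁₁
  set M₂₂ : Matrix κ₂ κ₂ ℂ := Matrix.of fun k k' : κ₂ =>
    Mf (ρ (erow (Sum.inr k))) (ρ' (ecol (Sum.inr k'))) with hM₂₂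
  set N : Matrix ι ι ℂ := Matrix.of fun i j : ι =>
    Mf (ρ i) (ρ' j) * (if top i ∧ top' j then 1 + μ else 1) with hN
  set N' : Matrix (κ₁ ⊕ κ₂) (κ₁ ⊕ κ₂) ℂ := N.submatrix erow ecol with hN'
  have hdet : N'.det ≠ 0 → N.det ≠ 0 := by
    intro h hz
    apply h
    have hNN : N' = (N.submatrix id ⇑(erow.symm.trans ecol)).submatrix erow erow := by
      ext i j
      simp [hN', Matrix.submatrix_apply]
    rw [hNN, Matrix.det_submatrix_equiv_self, Matrix.det_permute', hz, mul_zero]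
  apply hdet
  set Qm : Matrix κ₁ κ₂ ℂ := Matrix.of fun (k : κ₁) (k₂ : κ₂) => if k = c₂ k₂ then (1 : ℂ) else 0
    with hQm
  have hmulQ₁ : ∀ (Z : Matrix κ₁ κ₁ ℂ) (i : κ₁) (k₂ : κ₂), (Z * Qm) i k₂ = Z i (c₂ k₂) := by
    intro Z i k₂
    simp [Matrix.mul_apply, hQm, mul_ite, Finset.sum_ite_eq']
  have hmulQ₂ : ∀ (Z : Matrix κ₂ κ₁ ℂ) (i : κ₂) (k₂ : κ₂), (Z * Qm) i k₂ = Z i (c₂ k₂) := by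
    intro Z i k₂
    simp [Matrix.mul_apply, hQm, mul_ite, Finset.sum_ite_eq']
  set A₁₁ : Matrix κ₁ κ₁ ℂ := Matrix.of fun k k' => N (erow (Sum.inl k)) (ecol (Sum.inl k'))
    with hA₁₁
  set A₁₂ : Matrix κ₁ κ₂ ℂ := Matrix.of fun k k' => N (erow (Sum.inl k)) (ecol (Sum.inr k'))
    with hA₁₂
  set A₂₁ : Matrix κ₂ κ₁ ℂ := Matrix.of fun k k' => N (erow (Sum.inr k)) (ecol (Sum.inl k'))
    with hA₂₁
  set A₂₂ : Matrix κ₂ κ₂ ℂ := Matrix.of fun k k' => N (erow (Sum.inr k)) (ecol (Sum.inr k'))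
    with hA₂₂
  have hN'b : N' = Matrix.fromBlocks A₁₁ A₁₂ A₂₁ A₂₂ := by
    ext (i | i) (j | j) <;> rfl
  have key : N' * Matrix.fromBlocks 1 (-Qm) 0 1 = Matrix.fromBlocks M₁₁ 0 A₂₁ (μ • M₂₂) := by
    rw [hN'b, Matrix.fromBlocks_multiply]
    simp only [Matrix.mul_one, Matrix.mul_zero, add_zero, Matrix.mul_neg]
    ext (k | k) (k' | k')
    · simp only [Matrix.fromBlocks_apply₁₁, hA₁₁, Matrix.of_apply, hN, hM₁₁]
      have h0 := hr₀ k
      simp [h0]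
    · simp only [Matrix.fromBlocks_apply₁₂, Matrix.add_apply, Matrix.neg_apply, hmulQ₁,
        hA₁₁, hA₁₂, Matrix.of_apply, hN, Matrix.zero_apply]
      rw [hc₃ k']
      have h0 := hr₀ k
      simp [h0]
    · rfl
    · simp only [Matrix.fromBlocks_apply₂₂, Matrix.add_apply, Matrix.neg_apply, hmulQ₂,
        hA₂₁, hA₂₂, Matrix.of_apply, hN, hM₂₂, Matrix.smul_apply, smul_eq_mul]
      rw [hc₃ k']
      have h1 := hc₁ k'
      have h2 := hc₂ k'
      have h3 := hr₁ k
      simp [h1, h2, h3]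
      ring
  have hC : (Matrix.fromBlocks (1 : Matrix κ₁ κ₁ ℂ) (-Qm) 0 (1 : Matrix κ₂ κ₂ ℂ)).det = 1 := by
    rw [Matrix.det_fromBlocks_zero₂₁, Matrix.det_one, Matrix.det_one, mul_one]
  intro hz
  have hk := congrArg Matrix.det key
  rw [Matrix.det_mul, hC, mul_one, hz, Matrix.det_fromBlocks_zero₁₂, Matrix.det_smul] at hk
  exact mul_ne_zero H₁ (mul_ne_zero (pow_ne_zero _ hμ) H₂) hk.symm

end Engine

/-! ## 2. The sized gadget -/

variable {h : ℕ}

/-- The witness `g₀ · ((1 + x_a)(1 + y_c) + μ x_a y_c)`: size `≤ L(g) + 7`, degree `≤ deg g + 2`,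
layout matrix `coeff_{x^{U∖a} y^{W∖c}} g · (1 + μ·[a ∈ U][c ∈ W])`. -/
theorem exists_sized_twinGadget {ι : Type*} [Fintype ι] [DecidableEq ι]
    (u w : ι → Finset (Fin h)) (a c : Fin h) (g : MvPolynomial (Fin (h + h)) ℂ) (μ : ℂ) :
    ∃ f : MvPolynomial (Fin (h + h)) ℂ, complexity f ≤ complexity g + 7 ∧
      f.totalDegree ≤ g.totalDegree + 2 ∧
      (Matrix.of fun i j : ι => MvPolynomial.coeff
        (∑ a' ∈ u i, Finsupp.single (Fin.castAdd h a') 1 +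
          ∑ c' ∈ w j, Finsupp.single (Fin.natAdd h c') 1) f) =
      Matrix.of fun i j : ι => MvPolynomial.coeff
          (∑ a' ∈ (u i).erase a, Finsupp.single (Fin.castAdd h a') 1 +
            ∑ c' ∈ (w j).erase c, Finsupp.single (Fin.natAdd h c') 1 : Fin (h + h) →₀ ℕ) g *
          (if a ∈ u i ∧ c ∈ w j then 1 + μ else 1) := by
  classical
  set xa : Fin (h + h) := Fin.castAdd h a with hxa
  set yc : Fin (h + h) := Fin.natAdd h c with hyc
  set g₀ : MvPolynomial (Fin (h + h)) ℂ := ∑ d ∈ g.support with (d xa = 0 ∧ d yc = 0),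
      MvPolynomial.monomial d (MvPolynomial.coeff d g) with hg₀
  set G : MvPolynomial (Fin (h + h)) ℂ := (1 + MvPolynomial.X xa) * (1 + MvPolynomial.X yc) +
      MvPolynomial.C μ * (MvPolynomial.X xa * MvPolynomial.X yc) with hG
  refine ⟨g₀ * G, ?_, ?_, ?_⟩
  · -- size
    have hX : ∀ s : Fin (h + h), complexity (1 + MvPolynomial.X s : MvPolynomial (Fin (h + h)) ℂ) ≤ 1 :=
      fun s => by
        calc _ ≤ complexity (1 : MvPolynomial (Fin (h + h)) ℂ) +
              complexity (MvPolynomial.X s : MvPolynomial (Fin (h + h)) ℂ) + 1 :=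
              complexity_add_le_holds _ _
          _ = 1 := by rw [← MvPolynomial.C_1, complexity_C_holds, complexity_X_holds]
    have hG6 : complexity G ≤ 6 := by
      calc complexity G ≤ complexity ((1 + MvPolynomial.X xa) * (1 + MvPolynomial.X yc)) +
            complexity (MvPolynomial.C μ * (MvPolynomial.X xa * MvPolynomial.X yc)) + 1 :=
            complexity_add_le_holds _ _
        _ ≤ (complexity (1 + MvPolynomial.X xa : MvPolynomial (Fin (h + h)) ℂ) +
              complexity (1 + MvPolynomial.X yc : MvPolynomial (Fin (h + h)) ℂ) + 1) +
            (complexity (MvPolynomial.C μ : MvPolynomial (Fin (h + h)) ℂ) +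
              complexity (MvPolynomial.X xa * MvPolynomial.X yc) + 1) + 1 := by
            gcongr
            · exact complexity_mul_le_holds _ _
            · exact complexity_mul_le_holds _ _
        _ ≤ (1 + 1 + 1) + (0 + (complexity (MvPolynomial.X xa : MvPolynomial (Fin (h + h)) ℂ) +
              complexity (MvPolynomial.X yc : MvPolynomial (Fin (h + h)) ℂ) + 1) + 1) + 1 := by
            gcongr
            · exact hX xa
            · exact hX yc
            · exact (complexity_C_holds _).le
            · exact complexity_mul_le_holds _ _
        _ = 6 := by rw [complexity_X_holds, complexity_X_holds]
    calc complexity (g₀ * G) ≤ complexity g₀ + complexity G + 1 := complexity_mul_le_holds _ _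
      _ ≤ complexity g + 6 + 1 := by
          gcongr
          exact complexity_killVars_le xa yc g
      _ = complexity g + 7 := by ring
  · -- degree
    have hX : ∀ s : Fin (h + h), (1 + MvPolynomial.X s : MvPolynomial (Fin (h + h)) ℂ).totalDegree ≤ 1 :=
      fun s => (MvPolynomial.totalDegree_add _ _).trans (max_le (by simp) (by
        rw [MvPolynomial.totalDegree_X]))
    have hG2 : G.totalDegree ≤ 2 := by
      refine (MvPolynomial.totalDegree_add _ _).trans (max_le ?_ ?_)
      · exact (MvPolynomial.totalDegree_mul _ _).trans (add_le_add (hX xa) (hX yc))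
      · refine (MvPolynomial.totalDegree_mul _ _).trans ?_
        rw [MvPolynomial.totalDegree_C, zero_add]
        refine (MvPolynomial.totalDegree_mul _ _).trans ?_
        rw [MvPolynomial.totalDegree_X, MvPolynomial.totalDegree_X]
    calc (g₀ * G).totalDegree ≤ g₀.totalDegree + G.totalDegree := MvPolynomial.totalDegree_mul _ _
      _ ≤ g.totalDegree + 2 := add_le_add (totalDegree_killVars_le xa yc g) hG2
  · ext i j
    rw [Matrix.of_apply, Matrix.of_apply, hg₀, hG, hxa, hyc, coeff_twinGadget, mul_comm]

/-! ## 3. The twin-absorption doors -/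

/-- **Twin absorption, rows** (item 19717, 𝒟-side). Layout `(u, w)` on any index type; coordinate
pair `(a, c)`. Rows: `erow : κ₁ ⊕ κ₂ ≃ ι` = representatives ⊕ twin tops, the twin top `k ∋ a` has
the bottom `c₁ k ∌ a` with the same contraction. Columns: `ecol : κ₁ ⊕ κ₂ ≃ ι` = (columns `∌ c`) ⊕
(columns `∋ c`). If ONE `g` has nonsingular contracted layout matrices on representatives ×
(columns `∌ c`) and on twin tops × (columns `∋ c`), then some `f` with `L(f) ≤ L(g) + 7`,
`deg f ≤ deg g + 2` has a nonsingular layout matrix on `(u, w)`. -/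
theorem partitionMinor_hit_of_twinAbsorptionRows {ι κ₁ κ₂ : Type*} [Fintype ι] [DecidableEq ι]
    [Fintype κ₁] [DecidableEq κ₁] [Fintype κ₂] [DecidableEq κ₂]
    (u w : ι → Finset (Fin h)) (a c : Fin h) (erow ecol : κ₁ ⊕ κ₂ ≃ ι) (c₁ : κ₂ → κ₁)
    (hr₁ : ∀ k, a ∉ u (erow (Sum.inl (c₁ k)))) (hr₂ : ∀ k, a ∈ u (erow (Sum.inr k)))
    (hr₃ : ∀ k, (u (erow (Sum.inr k))).erase a = (u (erow (Sum.inl (c₁ k)))).erase a)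
    (hc₀ : ∀ k, c ∉ w (ecol (Sum.inl k))) (hc₁ : ∀ k, c ∈ w (ecol (Sum.inr k)))
    (g : MvPolynomial (Fin (h + h)) ℂ)
    (hg₁ : (Matrix.of fun k k' : κ₁ => MvPolynomial.coeff
        (∑ a' ∈ (u (erow (Sum.inl k))).erase a, Finsupp.single (Fin.castAdd h a') 1 +
          ∑ c' ∈ (w (ecol (Sum.inl k'))).erase c, Finsupp.single (Fin.natAdd h c') 1) g).det ≠ 0)
    (hg₂ : (Matrix.of fun k k' : κ₂ => MvPolynomial.coeff
        (∑ a' ∈ (u (erow (Sum.inr k))).erase a, Finsupp.single (Fin.castAdd h a') 1 +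
          ∑ c' ∈ (w (ecol (Sum.inr k'))).erase c, Finsupp.single (Fin.natAdd h c') 1) g).det ≠ 0) :
    ∃ f : MvPolynomial (Fin (h + h)) ℂ, complexity f ≤ complexity g + 7 ∧
      f.totalDegree ≤ g.totalDegree + 2 ∧
      (Matrix.of fun i j : ι => MvPolynomial.coeff
        (∑ a' ∈ u i, Finsupp.single (Fin.castAdd h a') 1 +
          ∑ c' ∈ w j, Finsupp.single (Fin.natAdd h c') 1) f).det ≠ 0 := by
  classical
  obtain ⟨f, hf₁, hf₂, hf₃⟩ := exists_sized_twinGadget u w a c g 1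
  refine ⟨f, hf₁, hf₂, ?_⟩
  rw [hf₃]
  exact det_twinAbsorbRows_ne_zero (κ₁ := κ₁) (κ₂ := κ₂)
    (fun ρ ρ' : Finset (Fin h) => MvPolynomial.coeff
      (∑ a' ∈ ρ, Finsupp.single (Fin.castAdd h a') 1 + ∑ c' ∈ ρ', Finsupp.single (Fin.natAdd h c') 1 :
        Fin (h + h) →₀ ℕ) g)
    (fun i => (u i).erase a) (fun j => (w j).erase c) (fun i => a ∈ u i) (fun j => c ∈ w j)
    erow ecol c₁ hr₁ hr₂ hr₃ hc₀ hc₁ 1 one_ne_zero hg₁ hg₂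

/-- **Twin absorption, columns** (the transpose of `partitionMinor_hit_of_twinAbsorptionRows`).
Rows: `erow : κ₁ ⊕ κ₂ ≃ ι` = (rows `∌ a`) ⊕ (rows `∋ a`); columns: representatives ⊕ twin tops
with bottoms `c₂`. -/
theorem partitionMinor_hit_of_twinAbsorptionCols {ι κ₁ κ₂ : Type*} [Fintype ι] [DecidableEq ι]
    [Fintype κ₁] [DecidableEq κ₁] [Fintype κ₂] [DecidableEq κ₂]
    (u w : ι → Finset (Fin h)) (a c : Fin h) (erow ecol : κ₁ ⊕ κ₂ ≃ ι) (c₂ : κ₂ → κ₁)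
    (hr₀ : ∀ k, a ∉ u (erow (Sum.inl k))) (hr₁ : ∀ k, a ∈ u (erow (Sum.inr k)))
    (hc₁ : ∀ k, c ∉ w (ecol (Sum.inl (c₂ k)))) (hc₂ : ∀ k, c ∈ w (ecol (Sum.inr k)))
    (hc₃ : ∀ k, (w (ecol (Sum.inr k))).erase c = (w (ecol (Sum.inl (c₂ k)))).erase c)
    (g : MvPolynomial (Fin (h + h)) ℂ)
    (hg₁ : (Matrix.of fun k k' : κ₁ => MvPolynomial.coeff
        (∑ a' ∈ (u (erow (Sum.inl k))).erase a, Finsupp.single (Fin.castAdd h a') 1 +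
          ∑ c' ∈ (w (ecol (Sum.inl k'))).erase c, Finsupp.single (Fin.natAdd h c') 1) g).det ≠ 0)
    (hg₂ : (Matrix.of fun k k' : κ₂ => MvPolynomial.coeff
        (∑ a' ∈ (u (erow (Sum.inr k))).erase a, Finsupp.single (Fin.castAdd h a') 1 +
          ∑ c' ∈ (w (ecol (Sum.inr k'))).erase c, Finsupp.single (Fin.natAdd h c') 1) g).det ≠ 0) :
    ∃ f : MvPolynomial (Fin (h + h)) ℂ, complexity f ≤ complexity g + 7 ∧
      f.totalDegree ≤ g.totalDegree + 2 ∧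
      (Matrix.of fun i j : ι => MvPolynomial.coeff
        (∑ a' ∈ u i, Finsupp.single (Fin.castAdd h a') 1 +
          ∑ c' ∈ w j, Finsupp.single (Fin.natAdd h c') 1) f).det ≠ 0 := by
  classical
  obtain ⟨f, hf₁, hf₂, hf₃⟩ := exists_sized_twinGadget u w a c g 1
  refine ⟨f, hf₁, hf₂, ?_⟩
  rw [hf₃]
  exact det_twinAbsorbCols_ne_zero (κ₁ := κ₁) (κ₂ := κ₂)
    (fun ρ ρ' : Finset (Fin h) => MvPolynomial.coeff
      (∑ a' ∈ ρ, Finsupp.single (Fin.castAdd h a') 1 + ∑ c' ∈ ρ', Finsupp.single (Fin.natAdd h c') 1 :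
        Fin (h + h) →₀ ℕ) g)
    (fun i => (u i).erase a) (fun j => (w j).erase c) (fun i => a ∈ u i) (fun j => c ∈ w j)
    erow ecol c₂ hr₀ hr₁ hc₁ hc₂ hc₃ 1 one_ne_zero hg₁ hg₂

end Summit.ValiantsHypothesis.ValiantsHypothesis.Theorems.BarrierLever.TwinMatching
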